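import Literature.AlgebraicGeometry.Resolution.WeightedCentreGradedIsotropy
import Literature.AlgebraicGeometry.Resolution.WeightedCentreHeavyTaylor
import Literature.AlgebraicGeometry.Resolution.WeightedCentreLTKit
import Mathlib.RingTheory.MvPolynomial.WeightedHomogeneous
import Mathlib.Algebra.MvPolynomial.PDeriv
import Mathlib.Tactic.Linarith
import Mathlib.Tactic.FieldSimp
import HarnessLib

/-!
# Weighted centres — LEMMA XL ("pin ⇒ normal form") for graded isotropies of a layered form

Engine 1's THEOREM-F programme (RESOLUTION OBSERVATORY cell, characteristic `p` toy model `W(f)`), second proof of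
THEOREM F via LEMMA XL (engine notes THEOREM-F-eng1-g40 §4b).  This file is an INSTRUMENT for that toy model — a
statement about graded ring endomorphisms of `k[ε][σ]` — and NOT a resolution theorem.

## The statement (our `Φ`-frame; `A₀ = k[ε] = MvPolynomial ι k`, `σ = Polynomial.X`)

Fix rational weights `w > 0` on the slots `ε_i`, `deg σ = ρ > 0`, and a CLASS WEIGHT `c`.  Call a slot LIGHT if
`w i < c`, a CLASS slot if `w i = c`, HEAVIER if `c < w i`.  Let `Φ : A₀[σ] → A₀[σ]` be a graded ring endomorphism
(`IsGradedHom w ρ Φ`) which is the identity modulo `σ` on constants (`(Φ (C a)).coeff 0 = a`), fixes every heavier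
slot, and fixes `C g` for some `g ∈ A₀` (an isotropy of `g`; NO homogeneity of `g` is needed).  Put
`P := killLight (c ≤ w ·) g` (the light-free part of `g`) and assume the CONSTANT PIN MAP of the class is injective:

  (K)  `∀ T : ι → k` supported on the class, `Σ_j C (T j) * ∂_j P = 0 → T = 0`.

THEN there are LIGHT constants `m V ∈ k[LIGHT]`, `w`-homogeneous of weight `c`, one per class slot `V`, with

  `Φ (C (ε_V − m_V)) = C (ε_V − m_V)`                                                    (`exists_normalForm`)

i.e. after the graded triangular coordinate change `ε_V ↦ ε_V − m_V` the isotropy FIXES the class slots.  Iterating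
down the classes is engine 1's "F★ normal form"; hypothesis (K) is what the pin condition `(P)_C` of THEOREM F
delivers through LEMMA K (`p · c > wt g` makes every class exponent `< p`) — that derivation lives with the
class-linear pin file, this file isolates the characteristic-free mechanism.

## Proof mechanism (ours)

* the LIGHT-WEIGHT grading `ν := lightWt w c` (`= w` on light slots, `0` elsewhere): `P = ν`-component `0` of `g`,
  `ℛ := ν`-component `c` of `g` ("exactly one class factor replaced by light material of the same weight");
* a bookkeeping variable `t` counting class moves: `phiT : A₀ → A₀[σ][t]`, `ε_V ↦ ε_V + t·T_V` on the class
  (`T_V := Φ (C ε_V) − C ε_V`), `Φ` on light slots, identity on heavier ones; `t = 1` recovers `Φ ∘ C`, `t = 0` is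
  `phi0` ("`Φ` on the light material only"), and `[t¹]` is the first-order operator `a ↦ Σ_V T_V · phi0 (∂_V a)`;
* TRIGRADING: for `ν`-homogeneous `a` of weight `n`, `[t^j][σ^s] phiT a` is `ν`-homogeneous of weight
  `n + j c − s ρ`; reading off the `ν`-component of weight `c − s ρ` of `[σ^s] Φ (C g) = 0` (`s ≥ 1`) gives the
  LAYER IDENTITY `Σ_V [σ^s]T_V · ∂_V P = −[σ^s] phi0 ℛ`;
* COEFFICIENT EXTRACTION along class/heavier monomials `β` (`lightCoeff β`) turns it into
  `Σ_V Κ_{β V} • T_V = −(Φ (C r_β) − C r_β)` with the CONSTANT matrix `Κ_{β V} := coeff β (∂_V P)` and light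
  `r_β := lightCoeff β ℛ` of weight `c`; (K) makes `Κ` injective, and the constant left inverse of
  `WeightedCentreLTKit` (`apply_eq_map_of_leftInv`) yields `T_V = Φ (C m_V) − C m_V`, `m_V := −Σ_β λ_{V β} • r_β`.

References are CONTEXT: [AbramovichTemkinWlodarczyk2024, §5.1, Thm. 5.3.1] (weighted centres, graded coordinate
changes), [Lang2002, Ch. IV §1, Ch. XIII §4] (polynomial algebra, left inverses of injective matrices); every
declaration is "ours"/bookkeeping for the toy model.
-/

namespace Literature.AlgebraicGeometry.Resolution.WeightedBlowup

open Polynomial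

namespace LemmaXL

variable {k : Type*} [Field k] {ι : Type*}

/-! ## §1 The light-weight grading -/

/-- The LIGHT-WEIGHT grading `ν`: `w` on the slots lighter than `c`, `0` on the class and heavier slots (ours).
[cite: AbramovichTemkinWlodarczyk2024, §5.1 (p. 1575)] -/
def lightWt (w : ι → ℚ) (c : ℚ) : ι → ℚ := fun i => if w i < c then w i else 0

/-- Bookkeeping (ours). [cite: AbramovichTemkinWlodarczyk2024, §5.1 (p. 1575)] -/
theorem lightWt_of_lt {w : ι → ℚ} {c : ℚ} {i : ι} (h : w i < c) : lightWt w c i = w i := if_pos h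

/-- Bookkeeping (ours). [cite: AbramovichTemkinWlodarczyk2024, §5.1 (p. 1575)] -/
theorem lightWt_of_not_lt {w : ι → ℚ} {c : ℚ} {i : ι} (h : ¬ w i < c) : lightWt w c i = 0 := if_neg h

/-- `ν ≥ 0` for nonnegative weights (ours). [cite: AbramovichTemkinWlodarczyk2024, §5.1 (p. 1575)] -/
theorem lightWt_nonneg {w : ι → ℚ} (hw : ∀ i, 0 ≤ w i) (c : ℚ) (i : ι) : 0 ≤ lightWt w c i := by
  unfold lightWt; split_ifs <;> simp [hw i]

/-- A variable occurring in a monomial weighs at most the monomial (nonnegative weights) (ours).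
[cite: AbramovichTemkinWlodarczyk2024, §5.1 (p. 1575)] -/
theorem le_weight_of_mem_support {w : ι → ℚ} (hw : ∀ i, 0 ≤ w i) {d : ι →₀ ℕ} {i : ι} (hi : i ∈ d.support) :
    w i ≤ Finsupp.weight w d := by
  rw [Finsupp.weight_apply, Finsupp.sum]
  calc w i = 1 • w i := (one_nsmul _).symm
    _ ≤ d i • w i := nsmul_le_nsmul_left (hw i) (Nat.one_le_iff_ne_zero.mpr (Finsupp.mem_support_iff.mp hi))
    _ ≤ ∑ j ∈ d.support, d j • w j := Finset.single_le_sum (fun j _ => nsmul_nonneg (hw j) _) hi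

/-- Weights are nonnegative sums: `0 ≤ weight` (ours). [cite: AbramovichTemkinWlodarczyk2024, §5.1 (p. 1575)] -/
theorem weight_nonneg {w : ι → ℚ} (hw : ∀ i, 0 ≤ w i) (d : ι →₀ ℕ) : 0 ≤ Finsupp.weight w d := by
  rw [Finsupp.weight_apply, Finsupp.sum]
  exact Finset.sum_nonneg fun j _ => nsmul_nonneg (hw j) _

/-- A monomial of weight `< c` contains only light variables, so its `ν`-weight is its weight (ours).
[cite: AbramovichTemkinWlodarczyk2024, §5.1 (p. 1575)] -/
theorem weight_lightWt_eq_of_lt {w : ι → ℚ} (hw : ∀ i, 0 ≤ w i) {c : ℚ} {d : ι →₀ ℕ} (hd : Finsupp.weight w d < c) :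
    Finsupp.weight (lightWt w c) d = Finsupp.weight w d := by
  rw [Finsupp.weight_apply, Finsupp.weight_apply, Finsupp.sum, Finsupp.sum]
  refine Finset.sum_congr rfl fun i hi => ?_
  rw [lightWt_of_lt (lt_of_le_of_lt (le_weight_of_mem_support hw hi) hd)]

/-- A `w`-homogeneous constant of weight `m < c` is `ν`-homogeneous of the same weight (ours).
[cite: AbramovichTemkinWlodarczyk2024, §5.1 (p. 1575)] -/
theorem isWeightedHomogeneous_lightWt_of_lt {w : ι → ℚ} (hw : ∀ i, 0 ≤ w i) {c m : ℚ} (hm : m < c)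
    {a : MvPolynomial ι k} (ha : MvPolynomial.IsWeightedHomogeneous w a m) :
    MvPolynomial.IsWeightedHomogeneous (lightWt w c) a m := by
  intro d hd
  have hwd : Finsupp.weight w d = m := ha hd
  rw [weight_lightWt_eq_of_lt hw (hwd ▸ hm), hwd]

/-- `ν`-weight zero ⇔ no light variable, for POSITIVE weights (ours). [cite: AbramovichTemkinWlodarczyk2024, §5.1 (p. 1575)] -/
theorem weight_lightWt_eq_zero_iff {w : ι → ℚ} (hw : ∀ i, 0 < w i) (c : ℚ) (d : ι →₀ ℕ) :
    Finsupp.weight (lightWt w c) d = 0 ↔ IsHeavy (fun j => c ≤ w j) d := by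
  rw [Finsupp.weight_apply, Finsupp.sum,
    Finset.sum_eq_zero_iff_of_nonneg fun i _ => nsmul_nonneg (lightWt_nonneg (fun j => (hw j).le) c i) _]
  refine forall₂_congr fun i hi => ?_
  have hdi : d i ≠ 0 := Finsupp.mem_support_iff.mp hi
  by_cases h : w i < c
  · rw [lightWt_of_lt h]
    constructor
    · intro h0
      exact absurd h0 (smul_ne_zero hdi (hw i).ne')
    · intro hc
      exact absurd h (not_lt.mpr hc)
  · rw [lightWt_of_not_lt h, smul_zero]
    exact ⟨fun _ => not_lt.mp h, fun _ => rfl⟩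

/-- The `ν`-weight of a monomial is the `w`-weight of its light part (ours). [cite: AbramovichTemkinWlodarczyk2024, §5.1 (p. 1575)] -/
theorem weight_lightWt_eq_weight_filter [DecidableEq ι] (w : ι → ℚ) (c : ℚ) (d : ι →₀ ℕ) :
    Finsupp.weight (lightWt w c) d = Finsupp.weight w (d.filter fun i => w i < c) := by
  classical
  rw [Finsupp.weight_apply, Finsupp.weight_apply, Finsupp.sum, Finsupp.sum, Finsupp.support_filter,
    Finset.sum_filter]
  refine Finset.sum_congr rfl fun i _ => ?_
  by_cases h : w i < c
  · rw [if_pos h, Finsupp.filter_apply, if_pos h, lightWt_of_lt h]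
  · rw [if_neg h, lightWt_of_not_lt h, smul_zero]

/-- For POSITIVE weights the `ν`-component of weight `0` is the light-free part `killLight (c ≤ w ·)` (ours).
[cite: AbramovichTemkinWlodarczyk2024, §5.1 (p. 1575)] -/
theorem weightedHomogeneousComponent_lightWt_zero {w : ι → ℚ} (hw : ∀ i, 0 < w i) (c : ℚ) (G : MvPolynomial ι k) :
    MvPolynomial.weightedHomogeneousComponent (lightWt w c) 0 G = killLight (fun j => c ≤ w j) G := by
  classical
  ext t
  rw [MvPolynomial.coeff_weightedHomogeneousComponent, coeff_killLight]
  by_cases hH : IsHeavy (fun j => c ≤ w j) t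
  · rw [if_pos ((weight_lightWt_eq_zero_iff hw c t).mpr hH), if_pos hH]
  · rw [if_neg fun h => hH ((weight_lightWt_eq_zero_iff hw c t).mp h), if_neg hH]

/-! ## §2 Light constants and coefficient extraction along class/heavier monomials -/

/-- The light indicator grading `χ`: `0` on light slots, `1` on the others; `χ`-weight `0` means "light variables only"
(ours). [cite: AbramovichTemkinWlodarczyk2024, §5.1 (p. 1575)] -/
def lightInd (w : ι → ℚ) (c : ℚ) : ι → ℕ := fun i => if w i < c then 0 else 1

/-- `IsLight w c F`: the constant `F` involves light variables only (stated as `χ`-homogeneity of weight `0`, so that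
it is visibly closed under sums and products) (ours). [cite: AbramovichTemkinWlodarczyk2024, §5.1 (p. 1575)] -/
def IsLight (w : ι → ℚ) (c : ℚ) (F : MvPolynomial ι k) : Prop :=
  MvPolynomial.IsWeightedHomogeneous (lightInd w c) F 0

/-- `χ`-weight zero ⇔ all variables light (ours). [cite: AbramovichTemkinWlodarczyk2024, §5.1 (p. 1575)] -/
theorem weight_lightInd_eq_zero_iff (w : ι → ℚ) (c : ℚ) (d : ι →₀ ℕ) :
    Finsupp.weight (lightInd w c) d = 0 ↔ ∀ i ∈ d.support, w i < c := by
  rw [Finsupp.weight_apply, Finsupp.sum, Finset.sum_eq_zero_iff]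
  refine forall₂_congr fun i hi => ?_
  have hdi : d i ≠ 0 := Finsupp.mem_support_iff.mp hi
  unfold lightInd
  by_cases h : w i < c
  · simp [h]
  · simp [h, hdi]

namespace IsLight

variable {w : ι → ℚ} {c : ℚ}

/-- Variables of a light constant are light (ours). [cite: AbramovichTemkinWlodarczyk2024, §5.1 (p. 1575)] -/
theorem lt_of_mem_support {F : MvPolynomial ι k} (hF : IsLight w c F) {d : ι →₀ ℕ} (hd : d ∈ F.support) {i : ι}
    (hi : i ∈ d.support) : w i < c :=
  (weight_lightInd_eq_zero_iff w c d).mp (hF (MvPolynomial.mem_support_iff.mp hd)) i hi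

/-- Variables of a light constant are light (ours). [cite: AbramovichTemkinWlodarczyk2024, §5.1 (p. 1575)] -/
theorem lt_of_mem_vars {F : MvPolynomial ι k} (hF : IsLight w c F) {i : ι} (hi : i ∈ F.vars) :
    w i < c := by
  obtain ⟨d, hd, hid⟩ := (MvPolynomial.mem_vars_iff_mem_support i).mp hi
  exact hF.lt_of_mem_support hd hid

/-- Bookkeeping (ours). [cite: AbramovichTemkinWlodarczyk2024, §5.1 (p. 1575)] -/
theorem zero : IsLight w c (0 : MvPolynomial ι k) := MvPolynomial.isWeightedHomogeneous_zero _ _ _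

/-- Bookkeeping (ours). [cite: AbramovichTemkinWlodarczyk2024, §5.1 (p. 1575)] -/
theorem C (r : k) : IsLight w c (MvPolynomial.C r : MvPolynomial ι k) := MvPolynomial.isWeightedHomogeneous_C _ _

/-- Bookkeeping (ours). [cite: AbramovichTemkinWlodarczyk2024, §5.1 (p. 1575)] -/
theorem add {F G : MvPolynomial ι k} (hF : IsLight w c F) (hG : IsLight w c G) : IsLight w c (F + G) :=
  MvPolynomial.IsWeightedHomogeneous.add hF hG

/-- Bookkeeping (ours). [cite: AbramovichTemkinWlodarczyk2024, §5.1 (p. 1575)] -/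
theorem neg {F : MvPolynomial ι k} (hF : IsLight w c F) : IsLight w c (-F) :=
  (MvPolynomial.weightedHomogeneousSubmodule k (lightInd w c) 0).neg_mem hF

/-- Bookkeeping (ours). [cite: AbramovichTemkinWlodarczyk2024, §5.1 (p. 1575)] -/
theorem mul {F G : MvPolynomial ι k} (hF : IsLight w c F) (hG : IsLight w c G) : IsLight w c (F * G) := by
  have h := MvPolynomial.IsWeightedHomogeneous.mul hF hG
  rwa [add_zero] at h

/-- Bookkeeping (ours). [cite: AbramovichTemkinWlodarczyk2024, §5.1 (p. 1575)] -/
theorem smul (r : k) {F : MvPolynomial ι k} (hF : IsLight w c F) : IsLight w c (r • F) := by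
  rw [MvPolynomial.smul_eq_C_mul]; exact (IsLight.C r).mul hF

/-- Bookkeeping (ours). [cite: AbramovichTemkinWlodarczyk2024, §5.1 (p. 1575)] -/
theorem sum {α : Type*} (s : Finset α) {F : α → MvPolynomial ι k} (h : ∀ a ∈ s, IsLight w c (F a)) :
    IsLight w c (∑ a ∈ s, F a) :=
  MvPolynomial.IsWeightedHomogeneous.sum s _ _ h

/-- A monomial in light variables is light (ours). [cite: AbramovichTemkinWlodarczyk2024, §5.1 (p. 1575)] -/
theorem monomial {d : ι →₀ ℕ} (hd : ∀ i ∈ d.support, w i < c) (r : k) : IsLight w c (MvPolynomial.monomial d r) :=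
  MvPolynomial.isWeightedHomogeneous_monomial _ _ _ ((weight_lightInd_eq_zero_iff w c d).mpr hd)

/-- A `w`-homogeneous constant of weight `< c` is light (nonnegative weights) (ours).
[cite: AbramovichTemkinWlodarczyk2024, §5.1 (p. 1575)] -/
theorem of_isWeightedHomogeneous_lt (hw : ∀ i, 0 ≤ w i) {m : ℚ} (hm : m < c) {F : MvPolynomial ι k}
    (hF : MvPolynomial.IsWeightedHomogeneous w F m) : IsLight w c F := by
  intro d hd
  have hwd : Finsupp.weight w d = m := hF hd
  exact (weight_lightInd_eq_zero_iff w c d).mpr fun i hi =>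
    lt_of_le_of_lt (le_weight_of_mem_support hw hi) (hwd ▸ hm)

end IsLight

section Extract

variable (w : ι → ℚ) (c : ℚ)

/-- The class/heavier part of an exponent vector (ours). [cite: AbramovichTemkinWlodarczyk2024, §5.1 (p. 1575)] -/
noncomputable def nlPart (d : ι →₀ ℕ) : ι →₀ ℕ := d.filter fun i => ¬ w i < c

/-- The light part of an exponent vector (ours). [cite: AbramovichTemkinWlodarczyk2024, §5.1 (p. 1575)] -/
noncomputable def ltPart (d : ι →₀ ℕ) : ι →₀ ℕ := d.filter fun i => w i < c

/-- `d = nlPart d + ltPart d` (ours). [cite: AbramovichTemkinWlodarczyk2024, §5.1 (p. 1575)] -/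
theorem nlPart_add_ltPart (d : ι →₀ ℕ) : nlPart w c d + ltPart w c d = d := by
  rw [nlPart, ltPart, add_comm]
  exact Finsupp.filter_add_filter_not d _

/-- The light part has light support (ours). [cite: AbramovichTemkinWlodarczyk2024, §5.1 (p. 1575)] -/
theorem lt_of_mem_support_ltPart {d : ι →₀ ℕ} {i : ι} (hi : i ∈ (ltPart w c d).support) : w i < c := by
  rw [ltPart, Finsupp.support_filter, Finset.mem_filter] at hi
  exact hi.2

/-- The class/heavier part has no light variable (ours). [cite: AbramovichTemkinWlodarczyk2024, §5.1 (p. 1575)] -/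
theorem not_lt_of_mem_support_nlPart {d : ι →₀ ℕ} {i : ι} (hi : i ∈ (nlPart w c d).support) : ¬ w i < c := by
  rw [nlPart, Finsupp.support_filter, Finset.mem_filter] at hi
  exact hi.2

/-- For `γ` without light variables and `u` light: `nlPart (γ + u) = γ` (ours). [cite: AbramovichTemkinWlodarczyk2024, §5.1 (p. 1575)] -/
theorem nlPart_add_of {γ u : ι →₀ ℕ} (hγ : ∀ i ∈ γ.support, ¬ w i < c) (hu : ∀ i ∈ u.support, w i < c) :
    nlPart w c (γ + u) = γ := by
  rw [nlPart, Finsupp.filter_add, (Finsupp.filter_eq_self_iff _ _).mpr fun i hi => hγ i (Finsupp.mem_support_iff.mpr hi),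
    (Finsupp.filter_eq_zero_iff _ _).mpr fun i hi => ?_, add_zero]
  by_contra h
  exact hi (hu i (Finsupp.mem_support_iff.mpr h))

/-- For `γ` without light variables and `u` light: `ltPart (γ + u) = u` (ours). [cite: AbramovichTemkinWlodarczyk2024, §5.1 (p. 1575)] -/
theorem ltPart_add_of {γ u : ι →₀ ℕ} (hγ : ∀ i ∈ γ.support, ¬ w i < c) (hu : ∀ i ∈ u.support, w i < c) :
    ltPart w c (γ + u) = u := by
  rw [ltPart, Finsupp.filter_add, (Finsupp.filter_eq_zero_iff _ _).mpr fun i hi => ?_,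
    (Finsupp.filter_eq_self_iff _ _).mpr fun i hi => hu i (Finsupp.mem_support_iff.mpr hi), zero_add]
  by_contra h
  exact hγ i (Finsupp.mem_support_iff.mpr h) hi

variable [DecidableEq ι]

/-- COEFFICIENT EXTRACTION along the class/heavier monomial `β`: `Σ_d [nlPart d = β] · (coeff_d F) ε^{ltPart d}` —
the light polynomial multiplying `ε^β` in `F` (ours). [cite: AbramovichTemkinWlodarczyk2024, §5.1 (p. 1575)] -/
noncomputable def lightCoeff (β : ι →₀ ℕ) : MvPolynomial ι k →ₗ[k] MvPolynomial ι k :=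
  Finsupp.lsum k (fun d : ι →₀ ℕ =>
      if nlPart w c d = β then (MvPolynomial.monomial (ltPart w c d) : k →ₗ[k] MvPolynomial ι k) else 0)
    ∘ₗ (AddMonoidAlgebra.coeffLinearEquiv k).toLinearMap

/-- `lightCoeff β` of a monomial (ours). [cite: AbramovichTemkinWlodarczyk2024, §5.1 (p. 1575)] -/
theorem lightCoeff_monomial (β d : ι →₀ ℕ) (r : k) :
    lightCoeff w c β (MvPolynomial.monomial d r)
      = if nlPart w c d = β then MvPolynomial.monomial (ltPart w c d) r else 0 := by
  have : lightCoeff w c β (MvPolynomial.monomial d r) =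
      (if nlPart w c d = β then (MvPolynomial.monomial (ltPart w c d) : k →ₗ[k] MvPolynomial ι k) else 0) r :=
    MvPolynomial.sum_monomial_eq (LinearMap.map_zero _)
  rw [this]
  split_ifs <;> simp

/-- `lightCoeff β` unfolded as a sum over the support (ours). [cite: AbramovichTemkinWlodarczyk2024, §5.1 (p. 1575)] -/
theorem lightCoeff_apply (β : ι →₀ ℕ) (F : MvPolynomial ι k) :
    lightCoeff w c β F = ∑ d ∈ F.support,
      if nlPart w c d = β then MvPolynomial.monomial (ltPart w c d) (MvPolynomial.coeff d F) else 0 := by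
  conv_lhs => rw [F.as_sum, map_sum]
  refine Finset.sum_congr rfl fun d _ => ?_
  rw [lightCoeff_monomial]

/-- KEY FORMULA: for `γ` without light variables and light `ℓ`, `extract β (ε^γ · ℓ) = [γ = β] · ℓ` (ours).
[cite: AbramovichTemkinWlodarczyk2024, §5.1 (p. 1575)] -/
theorem lightCoeff_monomial_mul {β γ : ι →₀ ℕ} (hγ : ∀ i ∈ γ.support, ¬ w i < c) {ℓ : MvPolynomial ι k}
    (hℓ : IsLight w c ℓ) : lightCoeff w c β (MvPolynomial.monomial γ 1 * ℓ) = if γ = β then ℓ else 0 := by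
  conv_lhs => rw [ℓ.as_sum, Finset.mul_sum, map_sum]
  have hterm : ∀ u ∈ ℓ.support, lightCoeff w c β (MvPolynomial.monomial γ (1 : k) * MvPolynomial.monomial u (ℓ.coeff u))
      = if γ = β then MvPolynomial.monomial u (ℓ.coeff u) else 0 := by
    intro u hu
    have hul : ∀ i ∈ u.support, w i < c := fun i hi => hℓ.lt_of_mem_support hu hi
    rw [MvPolynomial.monomial_mul, one_mul, lightCoeff_monomial, nlPart_add_of w c hγ hul, ltPart_add_of w c hγ hul]
  rw [Finset.sum_congr rfl hterm]
  split_ifs with h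
  · exact ℓ.as_sum.symm
  · exact Finset.sum_const_zero

/-- `lightCoeff β F` is light (ours). [cite: AbramovichTemkinWlodarczyk2024, §5.1 (p. 1575)] -/
theorem isLight_lightCoeff (β : ι →₀ ℕ) (F : MvPolynomial ι k) : IsLight w c (lightCoeff w c β F) := by
  rw [lightCoeff_apply]
  refine IsLight.sum _ fun d _ => ?_
  split_ifs
  · exact IsLight.monomial (fun i hi => lt_of_mem_support_ltPart w c hi) _
  · exact IsLight.zero

/-- `lightCoeff β` of a `ν`-homogeneous constant of `ν`-weight `n` is `w`-homogeneous of weight `n` (ours).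
[cite: AbramovichTemkinWlodarczyk2024, §5.1 (p. 1575)] -/
theorem isWeightedHomogeneous_lightCoeff {F : MvPolynomial ι k} {n : ℚ}
    (hF : MvPolynomial.IsWeightedHomogeneous (lightWt w c) F n) (β : ι →₀ ℕ) :
    MvPolynomial.IsWeightedHomogeneous w (lightCoeff w c β F) n := by
  rw [lightCoeff_apply]
  refine MvPolynomial.IsWeightedHomogeneous.sum _ _ _ fun d hd => ?_
  split_ifs
  · refine MvPolynomial.isWeightedHomogeneous_monomial _ _ _ ?_
    rw [ltPart, ← weight_lightWt_eq_weight_filter]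
    exact hF (MvPolynomial.mem_support_iff.mp hd)
  · exact MvPolynomial.isWeightedHomogeneous_zero _ _ _

end Extract

/-! ## §3 `killLight` and partial derivatives -/

section KillLight

variable {S : Type*} [CommRing S] {H : ι → Prop} [DecidablePred H]

/-- `killLight` fixes scalars (bookkeeping; ours). [cite: AbramovichTemkinWlodarczyk2024, §5.1 (p. 1575)] -/
theorem killLight_C' (a : S) : killLight H (MvPolynomial.C a : MvPolynomial ι S) = MvPolynomial.C a := by
  rw [← MvPolynomial.algebraMap_eq]
  exact (killLight H).commutes a

/-- `∂_j` commutes with `killLight` for a HEAVY slot `j` (ours). [cite: AbramovichTemkinWlodarczyk2024, §5.1 (p. 1575)] -/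
theorem pderiv_killLight [DecidableEq ι] {j : ι} (hj : H j) (F : MvPolynomial ι S) :
    MvPolynomial.pderiv j (killLight H F) = killLight H (MvPolynomial.pderiv j F) := by
  induction F using MvPolynomial.induction_on with
  | C a => rw [killLight_C', MvPolynomial.pderiv_C, map_zero]
  | add p q hp hq => rw [map_add, map_add, hp, hq, map_add, map_add]
  | mul_X p i hp =>
    rw [map_mul, killLight_X, MvPolynomial.pderiv_mul, hp, MvPolynomial.pderiv_mul, map_add, map_mul, map_mul,
      killLight_X]
    congr 1
    by_cases hij : i = j
    · subst hij
      rw [heavyX, if_pos hj, MvPolynomial.pderiv_X_self, map_one]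
    · rw [MvPolynomial.pderiv_X_of_ne hij, map_zero, heavyX]
      split_ifs
      · rw [MvPolynomial.pderiv_X_of_ne hij]
      · rw [map_zero]

end KillLight

/-! ## §4 The bookkeeping homomorphisms `phi0`, `phiT` and the class moves `tMove` -/

section Phi

variable (w : ι → ℚ) (c : ℚ) (Φ : (MvPolynomial ι k)[X] →+* (MvPolynomial ι k)[X])

/-- The CLASS MOVES `T_i := Φ (C ε_i) − C ε_i` for a class slot `i` (`w i = c`), `0` for the other slots (ours).
[cite: AbramovichTemkinWlodarczyk2024, Thm. 5.3.1 (2)–(3) (p. 1578)] -/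
noncomputable def tMove (i : ι) : (MvPolynomial ι k)[X] :=
  if w i = c then Φ (C (MvPolynomial.X i)) - C (MvPolynomial.X i) else 0

/-- `phi0`: "`Φ` on the light material only" — the `k`-algebra map `k[ε] → k[ε][σ]` acting as `Φ ∘ C` on the light slots
and as `C` on the class and heavier slots (ours). [cite: AbramovichTemkinWlodarczyk2024, Thm. 5.3.1 (2)–(3) (p. 1578)] -/
noncomputable def phi0 : MvPolynomial ι k →ₐ[k] (MvPolynomial ι k)[X] :=
  MvPolynomial.aeval fun i => if w i < c then Φ (C (MvPolynomial.X i)) else C (MvPolynomial.X i)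

/-- `phiT`: the one-parameter bookkeeping family `ε_V ↦ phi0 ε_V + t · T_V` into `k[ε][σ][t]`; `t` COUNTS the class moves
(ours). [cite: AbramovichTemkinWlodarczyk2024, Thm. 5.3.1 (2)–(3) (p. 1578)] -/
noncomputable def phiT : MvPolynomial ι k →ₐ[k] Polynomial ((MvPolynomial ι k)[X]) :=
  MvPolynomial.aeval fun i => Polynomial.C (phi0 w c Φ (MvPolynomial.X i)) + Polynomial.monomial 1 (tMove w c Φ i)

/-- Bookkeeping (ours). [cite: AbramovichTemkinWlodarczyk2024, Thm. 5.3.1 (2)–(3) (p. 1578)] -/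
theorem tMove_of_ne {i : ι} (h : w i ≠ c) : tMove w c Φ i = 0 := if_neg h

/-- Bookkeeping (ours). [cite: AbramovichTemkinWlodarczyk2024, Thm. 5.3.1 (2)–(3) (p. 1578)] -/
theorem tMove_of_eq {i : ι} (h : w i = c) : tMove w c Φ i = Φ (C (MvPolynomial.X i)) - C (MvPolynomial.X i) := if_pos h

/-- Bookkeeping (ours). [cite: AbramovichTemkinWlodarczyk2024, Thm. 5.3.1 (2)–(3) (p. 1578)] -/
theorem phi0_X (i : ι) :
    phi0 w c Φ (MvPolynomial.X i) = if w i < c then Φ (C (MvPolynomial.X i)) else C (MvPolynomial.X i) :=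
  MvPolynomial.aeval_X _ _

/-- Bookkeeping (ours). [cite: AbramovichTemkinWlodarczyk2024, Thm. 5.3.1 (2)–(3) (p. 1578)] -/
theorem phi0_C (r : k) : phi0 w c Φ (MvPolynomial.C r) = C (MvPolynomial.C r) := by
  rw [phi0, MvPolynomial.algHom_C, Polynomial.algebraMap_apply, MvPolynomial.algebraMap_eq]

/-- Bookkeeping (ours). [cite: AbramovichTemkinWlodarczyk2024, Thm. 5.3.1 (2)–(3) (p. 1578)] -/
theorem phiT_X (i : ι) :
    phiT w c Φ (MvPolynomial.X i) = Polynomial.C (phi0 w c Φ (MvPolynomial.X i)) + Polynomial.monomial 1 (tMove w c Φ i) :=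
  MvPolynomial.aeval_X _ _

/-- Bookkeeping (ours). [cite: AbramovichTemkinWlodarczyk2024, Thm. 5.3.1 (2)–(3) (p. 1578)] -/
theorem phiT_C (r : k) : phiT w c Φ (MvPolynomial.C r) = Polynomial.C (Polynomial.C (MvPolynomial.C r)) := by
  rw [phiT, MvPolynomial.algHom_C, Polynomial.algebraMap_apply, Polynomial.algebraMap_apply, MvPolynomial.algebraMap_eq]

/-- `phi0` is `C` on the light-free constants `killLight (c ≤ w ·) F` (ours). [cite: AbramovichTemkinWlodarczyk2024, §5.1 (p. 1575)] -/
theorem phi0_killLight (F : MvPolynomial ι k) :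
    phi0 w c Φ (killLight (fun j => c ≤ w j) F) = C (killLight (fun j => c ≤ w j) F) := by
  induction F using MvPolynomial.induction_on with
  | C a => rw [killLight_C', phi0_C]
  | add p q hp hq => rw [map_add, map_add, hp, hq, map_add]
  | mul_X p i hp =>
    rw [map_mul, killLight_X, map_mul, hp, map_mul]
    congr 1
    rw [heavyX]
    split_ifs with h
    · rw [phi0_X, if_neg (not_lt.mpr h)]
    · rw [map_zero, map_zero]

/-- `phi0` is `Φ ∘ C` on light monomials (ours). [cite: AbramovichTemkinWlodarczyk2024, §5.1 (p. 1575)] -/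
theorem phi0_monomial_of_light (hC : ∀ r : k, Φ (C (MvPolynomial.C r)) = C (MvPolynomial.C r)) {u : ι →₀ ℕ}
    (hu : ∀ i ∈ u.support, w i < c) (a : k) :
    phi0 w c Φ (MvPolynomial.monomial u a) = Φ (C (MvPolynomial.monomial u a)) := by
  rw [phi0, MvPolynomial.aeval_monomial, Polynomial.algebraMap_apply, MvPolynomial.algebraMap_eq,
    MvPolynomial.monomial_eq, map_mul, map_mul, hC, Finsupp.prod, Finsupp.prod, map_prod, map_prod]
  congr 1
  refine Finset.prod_congr rfl fun i hi => ?_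
  rw [map_pow, map_pow, if_pos (hu i hi)]

/-- `phi0` is `Φ ∘ C` on LIGHT constants (ours). [cite: AbramovichTemkinWlodarczyk2024, §5.1 (p. 1575)] -/
theorem phi0_eq_of_isLight (hC : ∀ r : k, Φ (C (MvPolynomial.C r)) = C (MvPolynomial.C r)) {ℓ : MvPolynomial ι k}
    (hℓ : IsLight w c ℓ) : phi0 w c Φ ℓ = Φ (C ℓ) := by
  conv_lhs => rw [ℓ.as_sum, map_sum]
  conv_rhs => rw [ℓ.as_sum, map_sum, map_sum]
  exact Finset.sum_congr rfl fun u hu => phi0_monomial_of_light w c Φ hC (fun i hi => hℓ.lt_of_mem_support hu hi) _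

/-- Degree-one bookkeeping in `t` (ours). [cite: Lang2002, Ch. IV §1] -/
theorem coeff_mul_monomial_one_one (F : Polynomial ((MvPolynomial ι k)[X])) (r : (MvPolynomial ι k)[X]) :
    (F * Polynomial.monomial 1 r).coeff 1 = F.coeff 0 * r := by
  simpa using Polynomial.coeff_mul_monomial F 1 0 r

/-- Degree-zero bookkeeping in `t` (ours). [cite: Lang2002, Ch. IV §1] -/
theorem coeff_mul_monomial_one_zero (F : Polynomial ((MvPolynomial ι k)[X])) (r : (MvPolynomial ι k)[X]) :
    (F * Polynomial.monomial 1 r).coeff 0 = 0 := by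
  simp

/-- `t = 0`: the constant term of `phiT a` is `phi0 a` (ours). [cite: AbramovichTemkinWlodarczyk2024, Thm. 5.3.1 (2)–(3) (p. 1578)] -/
theorem coeff_phiT_zero (a : MvPolynomial ι k) : (phiT w c Φ a).coeff 0 = phi0 w c Φ a := by
  induction a using MvPolynomial.induction_on with
  | C r => rw [phiT_C, phi0_C, Polynomial.coeff_C_zero]
  | add p q hp hq => rw [map_add, map_add, Polynomial.coeff_add, hp, hq]
  | mul_X p i hp =>
    rw [map_mul, map_mul, Polynomial.mul_coeff_zero, hp, phiT_X, Polynomial.coeff_add, Polynomial.coeff_C_zero,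
      Polynomial.coeff_monomial, if_neg one_ne_zero, add_zero]

/-- `[t¹]`: the FIRST-ORDER OPERATOR `[t¹] phiT a = Σ_j T_j · phi0 (∂_j a)` (a `phi0`-derivation) (ours).
[cite: AbramovichTemkinWlodarczyk2024, Thm. 5.3.1 (2)–(3) (p. 1578)] -/
theorem coeff_phiT_one [Fintype ι] [DecidableEq ι] (a : MvPolynomial ι k) :
    (phiT w c Φ a).coeff 1 = ∑ j, tMove w c Φ j * phi0 w c Φ (MvPolynomial.pderiv j a) := by
  induction a using MvPolynomial.induction_on with
  | C r =>
    rw [phiT_C, Polynomial.coeff_C, if_neg one_ne_zero]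
    symm
    exact Finset.sum_eq_zero fun j _ => by rw [MvPolynomial.pderiv_C, map_zero, mul_zero]
  | add p q hp hq =>
    rw [map_add, Polynomial.coeff_add, hp, hq, ← Finset.sum_add_distrib]
    exact Finset.sum_congr rfl fun j _ => by rw [map_add, map_add, mul_add]
  | mul_X p i hp =>
    rw [map_mul, phiT_X, mul_add, Polynomial.coeff_add, Polynomial.coeff_mul_C, coeff_mul_monomial_one_one, hp,
      coeff_phiT_zero]
    have hsum : ∑ j, tMove w c Φ j * phi0 w c Φ (MvPolynomial.pderiv j (p * MvPolynomial.X i))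
        = ∑ j, tMove w c Φ j * phi0 w c Φ (MvPolynomial.pderiv j p) * phi0 w c Φ (MvPolynomial.X i)
          + ∑ j, (if j = i then tMove w c Φ j * phi0 w c Φ p else 0) := by
      rw [← Finset.sum_add_distrib]
      refine Finset.sum_congr rfl fun j _ => ?_
      rw [MvPolynomial.pderiv_mul, map_add, map_mul, mul_add, ← mul_assoc]
      congr 1
      split_ifs with hji
      · subst hji
        rw [MvPolynomial.pderiv_X_self, mul_one]
      · rw [MvPolynomial.pderiv_X_of_ne (Ne.symm hji), mul_zero, map_zero, mul_zero]
    rw [hsum, Finset.sum_ite_eq' Finset.univ i, if_pos (Finset.mem_univ i), Finset.sum_mul, mul_comm (phi0 w c Φ p)]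

/-- `t = 1` recovers `Φ ∘ C` (needs: scalars fixed, heavier slots fixed) (ours).
[cite: AbramovichTemkinWlodarczyk2024, Thm. 5.3.1 (2)–(3) (p. 1578)] -/
theorem eval_one_phiT (hC : ∀ r : k, Φ (C (MvPolynomial.C r)) = C (MvPolynomial.C r))
    (hfix : ∀ i, c < w i → Φ (C (MvPolynomial.X i)) = C (MvPolynomial.X i)) (a : MvPolynomial ι k) :
    (phiT w c Φ a).eval 1 = Φ (C a) := by
  induction a using MvPolynomial.induction_on with
  | C r => rw [phiT_C, Polynomial.eval_C, hC]
  | add p q hp hq => rw [map_add, Polynomial.eval_add, hp, hq, map_add, map_add]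
  | mul_X p i hp =>
    rw [map_mul, Polynomial.eval_mul, hp, map_mul, map_mul, phiT_X, Polynomial.eval_add, Polynomial.eval_C,
      Polynomial.eval_monomial, one_pow, mul_one, phi0_X, tMove]
    congr 1
    rcases lt_trichotomy (w i) c with h | h | h
    · rw [if_pos h, if_neg h.ne, add_zero]
    · rw [if_neg (h ▸ lt_irrefl c), if_pos h, add_sub_cancel]
    · rw [if_neg (not_lt.mpr h.le), if_neg h.ne', add_zero, hfix i h]

end Phi

/-! ## §5 The trigrading of `phiT` -/

section TriGrading

variable {ν : ι → ℚ} {c ρ : ℚ}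

/-- `IsTTW ν c ρ n F`: `[t^j] F ∈ k[ε][σ]` has total weight `n + j c` for the weights `(ν, deg σ = ρ)`, every `j` (ours).
[cite: AbramovichTemkinWlodarczyk2024, Thm. 5.3.1 (2)–(3) (p. 1578)] -/
def IsTTW (ν : ι → ℚ) (c ρ n : ℚ) (F : Polynomial ((MvPolynomial ι k)[X])) : Prop :=
  ∀ j : ℕ, IsTW ν ρ (n + j • c) (F.coeff j)

/-- Bookkeeping (ours). [cite: AbramovichTemkinWlodarczyk2024, Thm. 5.3.1 (2)–(3) (p. 1578)] -/
theorem isTTW_zero (n : ℚ) : IsTTW ν c ρ n (0 : Polynomial ((MvPolynomial ι k)[X])) := fun j => by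
  rw [Polynomial.coeff_zero]; exact isTW_zero _

/-- Bookkeeping (ours). [cite: AbramovichTemkinWlodarczyk2024, Thm. 5.3.1 (2)–(3) (p. 1578)] -/
theorem IsTTW.add {n : ℚ} {F G : Polynomial ((MvPolynomial ι k)[X])} (hF : IsTTW ν c ρ n F) (hG : IsTTW ν c ρ n G) :
    IsTTW ν c ρ n (F + G) := fun j => by
  rw [Polynomial.coeff_add]; exact (hF j).add (hG j)

/-- Bookkeeping (ours). [cite: AbramovichTemkinWlodarczyk2024, Thm. 5.3.1 (2)–(3) (p. 1578)] -/
theorem IsTTW.sum {α : Type*} (t : Finset α) {n : ℚ} {F : α → Polynomial ((MvPolynomial ι k)[X])}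
    (h : ∀ a ∈ t, IsTTW ν c ρ n (F a)) : IsTTW ν c ρ n (∑ a ∈ t, F a) := fun j => by
  rw [Polynomial.finsetSum_coeff]; exact IsTW.sum t fun a ha => h a ha j

/-- Bookkeeping (ours). [cite: AbramovichTemkinWlodarczyk2024, Thm. 5.3.1 (2)–(3) (p. 1578)] -/
theorem IsTTW.mul {m n : ℚ} {F G : Polynomial ((MvPolynomial ι k)[X])} (hF : IsTTW ν c ρ m F) (hG : IsTTW ν c ρ n G) :
    IsTTW ν c ρ (m + n) (F * G) := fun j => by
  rw [Polynomial.coeff_mul]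
  refine IsTW.sum _ fun x hx => ?_
  have e : m + n + j • c = m + x.1 • c + (n + x.2 • c) := by
    rw [← Finset.mem_antidiagonal.mp hx, add_nsmul]; ring
  rw [e]
  exact (hF x.1).mul (hG x.2)

/-- Bookkeeping (ours). [cite: AbramovichTemkinWlodarczyk2024, Thm. 5.3.1 (2)–(3) (p. 1578)] -/
theorem isTTW_C {n : ℚ} {f : (MvPolynomial ι k)[X]} (hf : IsTW ν ρ n f) : IsTTW ν c ρ n (Polynomial.C f) := fun j => by
  rw [Polynomial.coeff_C]
  split_ifs with h
  · subst h; rwa [zero_nsmul, add_zero]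
  · exact isTW_zero _

/-- Bookkeeping (ours). [cite: AbramovichTemkinWlodarczyk2024, Thm. 5.3.1 (2)–(3) (p. 1578)] -/
theorem isTTW_one : IsTTW ν c ρ 0 (1 : Polynomial ((MvPolynomial ι k)[X])) := by
  rw [← Polynomial.C_1]; exact isTTW_C isTW_one

/-- Bookkeeping (ours). [cite: AbramovichTemkinWlodarczyk2024, Thm. 5.3.1 (2)–(3) (p. 1578)] -/
theorem isTTW_monomial_one {n : ℚ} {f : (MvPolynomial ι k)[X]} (hf : IsTW ν ρ (n + c) f) :
    IsTTW ν c ρ n (Polynomial.monomial 1 f) := fun j => by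
  rw [Polynomial.coeff_monomial]
  split_ifs with h
  · subst h; rwa [one_nsmul]
  · exact isTW_zero _

/-- Bookkeeping (ours). [cite: AbramovichTemkinWlodarczyk2024, Thm. 5.3.1 (2)–(3) (p. 1578)] -/
theorem IsTTW.prod {α : Type*} (t : Finset α) {n : α → ℚ} {F : α → Polynomial ((MvPolynomial ι k)[X])}
    (h : ∀ a ∈ t, IsTTW ν c ρ (n a) (F a)) : IsTTW ν c ρ (∑ a ∈ t, n a) (∏ a ∈ t, F a) := by
  classical
  induction t using Finset.induction_on with
  | empty => rw [Finset.sum_empty, Finset.prod_empty]; exact isTTW_one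
  | insert a t hat ih =>
    rw [Finset.prod_insert hat, Finset.sum_insert hat]
    exact (h a (Finset.mem_insert_self a t)).mul (ih fun b hb => h b (Finset.mem_insert_of_mem hb))

/-- Bookkeeping (ours). [cite: AbramovichTemkinWlodarczyk2024, Thm. 5.3.1 (2)–(3) (p. 1578)] -/
theorem IsTTW.pow {m : ℚ} {F : Polynomial ((MvPolynomial ι k)[X])} (hF : IsTTW ν c ρ m F) :
    ∀ n : ℕ, IsTTW ν c ρ (n • m) (F ^ n)
  | 0 => by rw [pow_zero, zero_nsmul]; exact isTTW_one
  | n + 1 => by rw [pow_succ, succ_nsmul]; exact (IsTTW.pow hF n).mul hF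

end TriGrading

section PhiGrading

variable {w : ι → ℚ} {c ρ : ℚ} {Φ : (MvPolynomial ι k)[X] →+* (MvPolynomial ι k)[X]}

/-- The GENERATOR TRIGRADING: `phiT ε_i` has `(ν; c, ρ)`-weight `ν i` — light slots carry weight `w i` in `t`-degree `0`,
class slots weight `0` in `t`-degree `0` (`ε_V`) and weight `c` in `t`-degree `1` (`T_V`, light material of weight `c − sρ`),
heavier slots weight `0` (ours). [cite: AbramovichTemkinWlodarczyk2024, Thm. 5.3.1 (2)–(3) (p. 1578)] -/
theorem isTTW_phiT_X (hΦ : IsGradedHom w ρ Φ) (h0 : ∀ a, (Φ (C a)).coeff 0 = a) (hw : ∀ i, 0 ≤ w i) (hρ : 0 < ρ)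
    (i : ι) : IsTTW (lightWt w c) c ρ (lightWt w c i) (phiT w c Φ (MvPolynomial.X i)) := by
  rw [phiT_X]
  refine (isTTW_C ?_).add (isTTW_monomial_one ?_)
  · rw [phi0_X]
    split_ifs with h
    · rw [lightWt_of_lt h]
      intro s
      exact isWeightedHomogeneous_lightWt_of_lt hw (lt_of_le_of_lt (sub_le_self _ (nsmul_nonneg hρ.le s)) h)
        (hΦ.isTW_CX i s)
    · exact isTW_C (MvPolynomial.isWeightedHomogeneous_X k (lightWt w c) i)
  · by_cases h : w i = c
    · have hnl : ¬ w i < c := by rw [h]; exact lt_irrefl c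
      rw [tMove_of_eq w c Φ h, lightWt_of_not_lt hnl, zero_add]
      intro s
      rw [Polynomial.coeff_sub, Polynomial.coeff_C]
      rcases Nat.eq_zero_or_pos s with hs | hs
      · subst hs
        rw [if_pos rfl, h0, sub_self]
        exact MvPolynomial.isWeightedHomogeneous_zero _ _ _
      · rw [if_neg hs.ne', sub_zero]
        have h1 := hΦ.isTW_CX i s
        rw [h] at h1
        exact isWeightedHomogeneous_lightWt_of_lt hw (sub_lt_self c (nsmul_pos hρ hs.ne')) h1
    · rw [tMove_of_ne w c Φ h]
      exact isTW_zero _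

/-- TRIGRADING of `phiT`: for `ν`-homogeneous `a` of weight `n`, `[t^j][σ^s] phiT a` is `ν`-homogeneous of weight
`n + j c − s ρ` (ours). [cite: AbramovichTemkinWlodarczyk2024, Thm. 5.3.1 (2)–(3) (p. 1578)] -/
theorem isTTW_phiT (hΦ : IsGradedHom w ρ Φ) (h0 : ∀ a, (Φ (C a)).coeff 0 = a) (hw : ∀ i, 0 ≤ w i) (hρ : 0 < ρ)
    {a : MvPolynomial ι k} {n : ℚ} (ha : MvPolynomial.IsWeightedHomogeneous (lightWt w c) a n) :
    IsTTW (lightWt w c) c ρ n (phiT w c Φ a) := by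
  classical
  rw [a.as_sum, map_sum]
  refine IsTTW.sum _ fun d hd => ?_
  have hwd : Finsupp.weight (lightWt w c) d = n := ha (MvPolynomial.mem_support_iff.mp hd)
  rw [MvPolynomial.monomial_eq, map_mul, phiT_C, Finsupp.prod]
  simp only [map_prod, map_pow]
  have h := (isTTW_C (c := c) (isTW_C (ρ := ρ)
    (MvPolynomial.isWeightedHomogeneous_C (lightWt w c) (MvPolynomial.coeff d a)))).mul
    (IsTTW.prod d.support (n := fun i => d i • lightWt w c i) fun i _ => (isTTW_phiT_X hΦ h0 hw hρ i).pow (d i))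
  convert h using 2
  rw [zero_add, ← hwd, Finsupp.weight_apply, Finsupp.sum]

/-- COMPONENT FORMULA for a monomial: the `ν`-component of weight `m` of `[σ^s] Φ (C ε^d)` collects the `t`-degrees `j`
with `ν(d) + j c − s ρ = m` (ours). [cite: AbramovichTemkinWlodarczyk2024, Thm. 5.3.1 (2)–(3) (p. 1578)] -/
theorem weightedHomogeneousComponent_coeff_map_C_monomial (hΦ : IsGradedHom w ρ Φ) (h0 : ∀ a, (Φ (C a)).coeff 0 = a)
    (hfix : ∀ i, c < w i → Φ (C (MvPolynomial.X i)) = C (MvPolynomial.X i)) (hw : ∀ i, 0 ≤ w i) (hρ : 0 < ρ)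
    (d : ι →₀ ℕ) (r : k) (s : ℕ) (m : ℚ) {N : ℕ} (hN : (phiT w c Φ (MvPolynomial.monomial d r)).natDegree < N) :
    MvPolynomial.weightedHomogeneousComponent (lightWt w c) m ((Φ (C (MvPolynomial.monomial d r))).coeff s)
      = ∑ j ∈ Finset.range N, if Finsupp.weight (lightWt w c) d + j • c - s • ρ = m
          then ((phiT w c Φ (MvPolynomial.monomial d r)).coeff j).coeff s else 0 := by
  have hT := isTTW_phiT (c := c) hΦ h0 hw hρ (MvPolynomial.isWeightedHomogeneous_monomial (lightWt w c) d r rfl)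
  rw [← eval_one_phiT w c Φ hΦ.map_C_C hfix, Polynomial.eval_eq_sum_range' hN]
  simp only [one_pow, mul_one]
  rw [Polynomial.finsetSum_coeff, map_sum]
  refine Finset.sum_congr rfl fun j _ => ?_
  split_ifs with h
  · exact (h ▸ hT j s).weightedHomogeneousComponent_same
  · exact (hT j s).weightedHomogeneousComponent_ne m fun e => h e.symm

end PhiGrading

/-! ## §6 The layer identity and its extraction along class/heavier monomials -/

section Layer

variable [Fintype ι] [DecidableEq ι] {w : ι → ℚ} {c ρ : ℚ} {Φ : (MvPolynomial ι k)[X] →+* (MvPolynomial ι k)[X]}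

omit [Fintype ι] [DecidableEq ι] in
/-- COMPONENT FORMULA: the `ν`-component of weight `c − sρ` of `[σ^s] Φ (C g)` is `[t¹][σ^s] phiT P + [σ^s] phi0 ℛ` with
`P, ℛ` the `ν`-components of `g` of weights `0, c` ("one class move, or none") (ours).
[cite: AbramovichTemkinWlodarczyk2024, Thm. 5.3.1 (2)–(3) (p. 1578)] -/
theorem weightedHomogeneousComponent_coeff_map_C (hΦ : IsGradedHom w ρ Φ) (h0 : ∀ a, (Φ (C a)).coeff 0 = a)
    (hfix : ∀ i, c < w i → Φ (C (MvPolynomial.X i)) = C (MvPolynomial.X i)) (hw : ∀ i, 0 ≤ w i) (hρ : 0 < ρ)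
    (hc : 0 < c) (g : MvPolynomial ι k) (s : ℕ) :
    MvPolynomial.weightedHomogeneousComponent (lightWt w c) (c - s • ρ) ((Φ (C g)).coeff s)
      = ((phiT w c Φ (MvPolynomial.weightedHomogeneousComponent (lightWt w c) 0 g)).coeff 1).coeff s
        + (phi0 w c Φ (MvPolynomial.weightedHomogeneousComponent (lightWt w c) c g)).coeff s := by
  set N : ℕ := g.support.sup (fun d => (phiT w c Φ (MvPolynomial.monomial d (MvPolynomial.coeff d g))).natDegree) + 2
    with hN
  have hlt : ∀ d ∈ g.support, (phiT w c Φ (MvPolynomial.monomial d (MvPolynomial.coeff d g))).natDegree < N :=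
    fun d hd => lt_of_le_of_lt
      (Finset.le_sup (f := fun d => (phiT w c Φ (MvPolynomial.monomial d (MvPolynomial.coeff d g))).natDegree) hd)
      (by omega)
  conv_lhs => rw [g.as_sum, map_sum, map_sum, Polynomial.finsetSum_coeff, map_sum]
  rw [Finset.sum_congr rfl fun d hd => weightedHomogeneousComponent_coeff_map_C_monomial (c := c) hΦ h0 hfix hw hρ d
    (MvPolynomial.coeff d g) s (c - s • ρ) (hlt d hd)]
  have key : ∀ d ∈ g.support,
      (∑ j ∈ Finset.range N, if Finsupp.weight (lightWt w c) d + j • c - s • ρ = c - s • ρ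
          then ((phiT w c Φ (MvPolynomial.monomial d (MvPolynomial.coeff d g))).coeff j).coeff s else 0)
        = (if Finsupp.weight (lightWt w c) d = 0
            then ((phiT w c Φ (MvPolynomial.monomial d (MvPolynomial.coeff d g))).coeff 1).coeff s else 0)
          + (if Finsupp.weight (lightWt w c) d = c
            then ((phiT w c Φ (MvPolynomial.monomial d (MvPolynomial.coeff d g))).coeff 0).coeff s else 0) := by
    intro d _
    have hv : 0 ≤ Finsupp.weight (lightWt w c) d := weight_nonneg (lightWt_nonneg hw c) d
    rw [Finset.sum_eq_add 1 0 one_ne_zero ?_ ?_ ?_]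
    · congr 1
      · rw [one_nsmul]
        exact if_congr ⟨fun h => by linarith, fun h => by rw [h]; ring⟩ rfl rfl
      · rw [zero_nsmul]
        exact if_congr ⟨fun h => by linarith, fun h => by rw [h]; ring⟩ rfl rfl
    · rintro j - ⟨hj1, hj0⟩
      rw [if_neg]
      intro h
      have hj2 : (2 : ℚ) ≤ j := by exact_mod_cast (show 2 ≤ j by omega)
      rw [nsmul_eq_mul] at h
      nlinarith [mul_le_mul_of_nonneg_right hj2 hc.le]
    · intro h; exact absurd (Finset.mem_range.mpr (by omega)) h
    · intro h; exact absurd (Finset.mem_range.mpr (by omega)) h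
  rw [Finset.sum_congr rfl key, Finset.sum_add_distrib, ← Finset.sum_filter, ← Finset.sum_filter]
  conv_rhs => rw [MvPolynomial.weightedHomogeneousComponent_apply, MvPolynomial.weightedHomogeneousComponent_apply,
    map_sum, map_sum, Polynomial.finsetSum_coeff, Polynomial.finsetSum_coeff, Polynomial.finsetSum_coeff]
  congr 1
  refine Finset.sum_congr rfl fun d _ => ?_
  rw [coeff_phiT_zero]

/-- THE LAYER IDENTITY (engine 1's "C-degree-`(d_h − 1)` layer", all `h` at once): for an isotropy of `C g` and `s ≥ 1`,
`Σ_j [σ^s]T_j · ∂_j P + [σ^s] phi0 ℛ = 0` with `P = killLight (c ≤ w ·) g` and `ℛ` the `ν`-component of `g` of weight `c`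
(ours). [cite: AbramovichTemkinWlodarczyk2024, Thm. 5.3.1 (2)–(3) (p. 1578)] -/
theorem layer_identity (hΦ : IsGradedHom w ρ Φ) (h0 : ∀ a, (Φ (C a)).coeff 0 = a)
    (hfix : ∀ i, c < w i → Φ (C (MvPolynomial.X i)) = C (MvPolynomial.X i)) (hw : ∀ i, 0 < w i) (hρ : 0 < ρ)
    (hc : 0 < c) {g : MvPolynomial ι k} (hg : Φ (C g) = C g) {s : ℕ} (hs : s ≠ 0) :
    ∑ j, (tMove w c Φ j).coeff s * MvPolynomial.pderiv j (killLight (fun j => c ≤ w j) g)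
      + (phi0 w c Φ (MvPolynomial.weightedHomogeneousComponent (lightWt w c) c g)).coeff s = 0 := by
  have hw' : ∀ i, 0 ≤ w i := fun i => (hw i).le
  have h := weightedHomogeneousComponent_coeff_map_C hΦ h0 hfix hw' hρ hc g s
  rw [hg, Polynomial.coeff_C, if_neg hs, map_zero, coeff_phiT_one, weightedHomogeneousComponent_lightWt_zero hw,
    Polynomial.finsetSum_coeff] at h
  refine Eq.trans ?_ h.symm
  congr 1
  refine Finset.sum_congr rfl fun j _ => ?_
  by_cases hj : w j = c
  · rw [pderiv_killLight (H := fun j => c ≤ w j) hj.ge, phi0_killLight, Polynomial.coeff_mul_C]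
  · rw [tMove_of_ne w c Φ hj, Polynomial.coeff_zero, zero_mul, zero_mul, Polynomial.coeff_zero]

omit [Fintype ι] [DecidableEq ι] in
/-- `T_j` has no `σ`-free term (ours). [cite: AbramovichTemkinWlodarczyk2024, Thm. 5.3.1 (2)–(3) (p. 1578)] -/
theorem coeff_tMove_zero (h0 : ∀ a, (Φ (C a)).coeff 0 = a) (j : ι) : (tMove w c Φ j).coeff 0 = 0 := by
  by_cases hj : w j = c
  · rw [tMove_of_eq w c Φ hj, Polynomial.coeff_sub, h0, Polynomial.coeff_C_zero, sub_self]
  · rw [tMove_of_ne w c Φ hj, Polynomial.coeff_zero]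

omit [Fintype ι] [DecidableEq ι] in
/-- `[σ^s] T_j = [σ^s] Φ (C ε_j)` for `s ≥ 1` and a class slot `j` (ours). [cite: AbramovichTemkinWlodarczyk2024, Thm. 5.3.1 (2)–(3) (p. 1578)] -/
theorem coeff_tMove_of_ne_zero {s : ℕ} (hs : s ≠ 0) {j : ι} (hj : w j = c) :
    (tMove w c Φ j).coeff s = (Φ (C (MvPolynomial.X j))).coeff s := by
  rw [tMove_of_eq w c Φ hj, Polynomial.coeff_sub, Polynomial.coeff_C, if_neg hs, sub_zero]

omit [Fintype ι] [DecidableEq ι] in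
/-- `[σ^s] T_j` is LIGHT for `s ≥ 1` (weight `c − sρ < c`) (ours). [cite: AbramovichTemkinWlodarczyk2024, Thm. 5.3.1 (2)–(3) (p. 1578)] -/
theorem isLight_coeff_tMove (hΦ : IsGradedHom w ρ Φ) (hw : ∀ i, 0 ≤ w i) (hρ : 0 < ρ) {s : ℕ} (hs : s ≠ 0) (j : ι) :
    IsLight w c ((tMove w c Φ j).coeff s) := by
  by_cases hj : w j = c
  · rw [coeff_tMove_of_ne_zero hs hj]
    have h1 := hΦ.isTW_CX j s
    rw [hj] at h1
    exact IsLight.of_isWeightedHomogeneous_lt hw (sub_lt_self c (nsmul_pos hρ (by omega))) h1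
  · rw [tMove_of_ne w c Φ hj, Polynomial.coeff_zero]
    exact IsLight.zero

/-- EXTRACTION of the layer identity along the class/heavier monomial `β`: with the CONSTANT pin matrix
`Κ_{β j} := coeff β (∂_j P)` and the light `r_β := lightCoeff β ℛ` of weight `c`,
`Σ_j C Κ_{β j} · [σ^s]T_j + [σ^s] Φ (C r_β) = 0` for `s ≥ 1` (ours). [cite: AbramovichTemkinWlodarczyk2024, Thm. 5.3.1 (2)–(3) (p. 1578)] -/
theorem extracted_identity (hΦ : IsGradedHom w ρ Φ) (h0 : ∀ a, (Φ (C a)).coeff 0 = a)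
    (hfix : ∀ i, c < w i → Φ (C (MvPolynomial.X i)) = C (MvPolynomial.X i)) (hw : ∀ i, 0 < w i) (hρ : 0 < ρ)
    (hc : 0 < c) {g : MvPolynomial ι k} (hg : Φ (C g) = C g) {s : ℕ} (hs : s ≠ 0) (β : ι →₀ ℕ) :
    ∑ j, MvPolynomial.C (MvPolynomial.coeff β (MvPolynomial.pderiv j (killLight (fun j => c ≤ w j) g)))
        * (tMove w c Φ j).coeff s
      + (Φ (C (lightCoeff w c β (MvPolynomial.weightedHomogeneousComponent (lightWt w c) c g)))).coeff s = 0 := by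
  have hw' : ∀ i, 0 ≤ w i := fun i => (hw i).le
  have h := congrArg (lightCoeff w c β) (layer_identity hΦ h0 hfix hw hρ hc hg hs)
  rw [map_zero, map_add, map_sum] at h
  refine Eq.trans ?_ h
  congr 1
  · refine Finset.sum_congr rfl fun j _ => ?_
    by_cases hj : w j = c
    · rw [pderiv_killLight (H := fun j => c ≤ w j) hj.ge]
      set Q := killLight (fun j => c ≤ w j) (MvPolynomial.pderiv j g) with hQ
      have hT : IsLight w c ((tMove w c Φ j).coeff s) := isLight_coeff_tMove hΦ hw' hρ hs j
      conv_rhs => rw [Q.as_sum, Finset.mul_sum, map_sum]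
      have hterm : ∀ γ ∈ Q.support,
          lightCoeff w c β ((tMove w c Φ j).coeff s * MvPolynomial.monomial γ (MvPolynomial.coeff γ Q))
            = if γ = β then MvPolynomial.C (MvPolynomial.coeff γ Q) * (tMove w c Φ j).coeff s else 0 := by
        intro γ hγ
        have hheavy : IsHeavy (fun j => c ≤ w j) γ := by
          by_contra hh
          exact (MvPolynomial.mem_support_iff.mp hγ) (by rw [hQ, coeff_killLight, if_neg hh])
        have e : (tMove w c Φ j).coeff s * MvPolynomial.monomial γ (MvPolynomial.coeff γ Q)
            = MvPolynomial.monomial γ 1 * (MvPolynomial.C (MvPolynomial.coeff γ Q) * (tMove w c Φ j).coeff s) := by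
          rw [show MvPolynomial.monomial γ (MvPolynomial.coeff γ Q)
              = MvPolynomial.C (MvPolynomial.coeff γ Q) * MvPolynomial.monomial γ 1 by
            rw [MvPolynomial.C_mul_monomial, mul_one]]
          ring
        rw [e, lightCoeff_monomial_mul w c (fun i hi => not_lt.mpr (hheavy i hi)) ((IsLight.C _).mul hT)]
      rw [Finset.sum_congr rfl hterm, Finset.sum_ite_eq']
      split_ifs with hβ
      · rfl
      · rw [MvPolynomial.notMem_support_iff.mp hβ, map_zero, zero_mul]
    · rw [tMove_of_ne w c Φ hj, Polynomial.coeff_zero, mul_zero, zero_mul, map_zero]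
  · set R := MvPolynomial.weightedHomogeneousComponent (lightWt w c) c g with hR
    have hRh : MvPolynomial.IsWeightedHomogeneous (lightWt w c) R c := by
      rw [hR]; exact MvPolynomial.weightedHomogeneousComponent_isWeightedHomogeneous c g
    conv_rhs => rw [R.as_sum, map_sum, Polynomial.finsetSum_coeff, map_sum]
    conv_lhs => rw [lightCoeff_apply, map_sum, map_sum, Polynomial.finsetSum_coeff]
    refine Finset.sum_congr rfl fun d hd => ?_
    have hheavy : IsHeavy (fun j => c ≤ w j) (nlPart w c d) := fun i hi => not_lt.mp (not_lt_of_mem_support_nlPart w c hi)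
    have hsplit : MvPolynomial.monomial d (MvPolynomial.coeff d R)
        = killLight (fun j => c ≤ w j) (MvPolynomial.monomial (nlPart w c d) 1)
          * MvPolynomial.monomial (ltPart w c d) (MvPolynomial.coeff d R) := by
      rw [killLight_monomial, if_pos hheavy, MvPolynomial.monomial_mul, one_mul, nlPart_add_ltPart]
    have hwt : MvPolynomial.IsWeightedHomogeneous w (MvPolynomial.monomial (ltPart w c d) (MvPolynomial.coeff d R)) c := by
      refine MvPolynomial.isWeightedHomogeneous_monomial _ _ _ ?_
      rw [ltPart, ← weight_lightWt_eq_weight_filter]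
      exact hRh (MvPolynomial.mem_support_iff.mp hd)
    have hL : IsLight w c ((Φ (C (MvPolynomial.monomial (ltPart w c d) (MvPolynomial.coeff d R)))).coeff s) :=
      IsLight.of_isWeightedHomogeneous_lt hw' (sub_lt_self c (nsmul_pos hρ hs)) (hΦ.isTW_map_C hwt s)
    rw [hsplit, map_mul, phi0_killLight, killLight_monomial, if_pos hheavy,
      phi0_monomial_of_light w c Φ hΦ.map_C_C (fun i hi => lt_of_mem_support_ltPart w c hi), Polynomial.coeff_C_mul,
      lightCoeff_monomial_mul w c (fun i hi => not_lt_of_mem_support_nlPart w c hi) hL]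
    split_ifs
    · rfl
    · rw [map_zero, map_zero, Polynomial.coeff_zero]

end Layer

/-! ## §7 The constant pin matrix, its left inverse, and the normal form -/

section NormalForm

variable [Fintype ι] [DecidableEq ι] {w : ι → ℚ} {c ρ : ℚ} {Φ : (MvPolynomial ι k)[X] →+* (MvPolynomial ι k)[X]}

/-- FLATTENING of hypothesis (K): the constant pin matrix `(coeff β (∂_j P))_{β, j}` on (class slots) × (a finite set of
monomials containing the supports) has injective `mulVec` (ours). [cite: Lang2002, Ch. XIII §4] -/
theorem mulVec_injective_of_pin (P : MvPolynomial ι k) (CV : Finset ι) (BV : Finset (ι →₀ ℕ))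
    (hBV : ∀ j ∈ CV, (MvPolynomial.pderiv j P).support ⊆ BV)
    (hK : ∀ T : ι → k, (∀ j, j ∉ CV → T j = 0) →
      ∑ j, MvPolynomial.C (T j) * MvPolynomial.pderiv j P = 0 → T = 0) :
    Function.Injective (Matrix.of fun (b : {b // b ∈ BV}) (j : {j // j ∈ CV}) =>
      MvPolynomial.coeff b.1 (MvPolynomial.pderiv j.1 P)).mulVec := by
  set A := Matrix.of fun (b : {b // b ∈ BV}) (j : {j // j ∈ CV}) =>
    MvPolynomial.coeff b.1 (MvPolynomial.pderiv j.1 P) with hA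
  suffices hker : ∀ T, A.mulVec T = 0 → T = 0 by
    intro T₁ T₂ h
    exact sub_eq_zero.mp (hker (T₁ - T₂) (by rw [Matrix.mulVec_sub, h, sub_self]))
  intro T hT
  let T' : ι → k := fun j => if h : j ∈ CV then T ⟨j, h⟩ else 0
  have hT' : ∀ j, j ∉ CV → T' j = 0 := fun j hj => dif_neg hj
  have key : ∀ b : ι →₀ ℕ, ∑ j, T' j * MvPolynomial.coeff b (MvPolynomial.pderiv j P) = 0 := by
    intro b
    rw [← Finset.sum_subset (Finset.subset_univ CV) fun j _ hj => by rw [hT' j hj, zero_mul], ← Finset.sum_coe_sort]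
    by_cases hb : b ∈ BV
    · have h := congrFun hT ⟨b, hb⟩
      simp only [hA, Matrix.mulVec, dotProduct, Matrix.of_apply, Pi.zero_apply] at h
      rw [← h]
      refine Finset.sum_congr rfl fun j _ => ?_
      simp only [T', dif_pos j.2, mul_comm]
    · refine Finset.sum_eq_zero fun j _ => ?_
      rw [MvPolynomial.notMem_support_iff.mp fun h => hb (hBV j.1 j.2 h), mul_zero]
  have hsum : ∑ j, MvPolynomial.C (T' j) * MvPolynomial.pderiv j P = 0 := by
    ext b
    rw [MvPolynomial.coeff_sum, MvPolynomial.coeff_zero]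
    simp_rw [MvPolynomial.coeff_C_mul]
    exact key b
  have hT'0 := hK T' hT' hsum
  funext j
  have hj := congrFun hT'0 j.1
  simp only [T', dif_pos j.2, Pi.zero_apply] at hj
  exact hj

/-- `a ↦ Φ (C a)` as a `k`-LINEAR map, for a scalar-fixing `Φ` (ours). [cite: Lang2002, Ch. XIII §4] -/
noncomputable def mapC (Φ : (MvPolynomial ι k)[X] →+* (MvPolynomial ι k)[X])
    (hC : ∀ r : k, Φ (C (MvPolynomial.C r)) = C (MvPolynomial.C r)) : MvPolynomial ι k →ₗ[k] (MvPolynomial ι k)[X] where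
  toFun a := Φ (C a)
  map_add' a b := by rw [map_add, map_add]
  map_smul' r a := by
    rw [RingHom.id_apply, MvPolynomial.smul_eq_C_mul, map_mul, map_mul, hC, Algebra.smul_def, Polynomial.algebraMap_apply,
      MvPolynomial.algebraMap_eq]

/-- The `k`-linear operator `D F := Φ (C [σ⁰]F) − F` of LEMMA LL Statement B (ours). [cite: Lang2002, Ch. XIII §4] -/
noncomputable def opD (Φ : (MvPolynomial ι k)[X] →+* (MvPolynomial ι k)[X])
    (hC : ∀ r : k, Φ (C (MvPolynomial.C r)) = C (MvPolynomial.C r)) : (MvPolynomial ι k)[X] →ₗ[k] (MvPolynomial ι k)[X] :=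
  mapC Φ hC ∘ₗ (Polynomial.lcoeff (MvPolynomial ι k) 0).restrictScalars k - LinearMap.id

omit [Fintype ι] [DecidableEq ι] in
/-- Bookkeeping (ours). [cite: Lang2002, Ch. XIII §4] -/
theorem opD_apply (hC : ∀ r : k, Φ (C (MvPolynomial.C r)) = C (MvPolynomial.C r)) (F : (MvPolynomial ι k)[X]) :
    opD Φ hC F = Φ (C (F.coeff 0)) - F := rfl

/-- THE MODULE IDENTITY `(ID_β)`: `Σ_{j ∈ class} Κ_{β j} • T_j = D(−C r_β)` in the `k`-module `k[ε][σ]` (ours).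
[cite: AbramovichTemkinWlodarczyk2024, Thm. 5.3.1 (2)–(3) (p. 1578)] -/
theorem module_identity (hΦ : IsGradedHom w ρ Φ) (h0 : ∀ a, (Φ (C a)).coeff 0 = a)
    (hfix : ∀ i, c < w i → Φ (C (MvPolynomial.X i)) = C (MvPolynomial.X i)) (hw : ∀ i, 0 < w i) (hρ : 0 < ρ)
    (hc : 0 < c) {g : MvPolynomial ι k} (hg : Φ (C g) = C g) (β : ι →₀ ℕ) :
    ∑ j : {j // j ∈ Finset.univ.filter fun j => w j = c},
        MvPolynomial.coeff β (MvPolynomial.pderiv j.1 (killLight (fun j => c ≤ w j) g)) • tMove w c Φ j.1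
      = opD Φ hΦ.map_C_C
          (-C (lightCoeff w c β (MvPolynomial.weightedHomogeneousComponent (lightWt w c) c g))) := by
  set rβ := lightCoeff w c β (MvPolynomial.weightedHomogeneousComponent (lightWt w c) c g) with hrβ
  rw [opD_apply, Polynomial.coeff_neg, Polynomial.coeff_C_zero, map_neg, map_neg, sub_neg_eq_add]
  have hfull : ∑ j : {j // j ∈ Finset.univ.filter fun j => w j = c},
      MvPolynomial.coeff β (MvPolynomial.pderiv j.1 (killLight (fun j => c ≤ w j) g)) • tMove w c Φ j.1
        = ∑ j, MvPolynomial.coeff β (MvPolynomial.pderiv j (killLight (fun j => c ≤ w j) g)) • tMove w c Φ j := by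
    rw [Finset.sum_coe_sort (Finset.univ.filter fun j => w j = c)
      (fun j => MvPolynomial.coeff β (MvPolynomial.pderiv j (killLight (fun j => c ≤ w j) g)) • tMove w c Φ j)]
    refine Finset.sum_subset (Finset.subset_univ _) fun j _ hj => ?_
    have hj' : w j ≠ c := by simpa using hj
    rw [tMove_of_ne w c Φ hj', smul_zero]
  rw [hfull]
  refine Polynomial.ext fun s => ?_
  rw [Polynomial.finsetSum_coeff, Polynomial.coeff_add, Polynomial.coeff_neg, Polynomial.coeff_C]
  simp_rw [Polynomial.coeff_smul, MvPolynomial.smul_eq_C_mul]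
  by_cases hs : s = 0
  · subst hs
    rw [if_pos rfl, h0, neg_add_cancel]
    exact Finset.sum_eq_zero fun j _ => by rw [coeff_tMove_zero h0, mul_zero]
  · rw [if_neg hs, add_zero]
    have h := extracted_identity hΦ h0 hfix hw hρ hc hg hs β
    exact eq_neg_of_add_eq_zero_left h

/-- **LEMMA XL ("pin ⇒ normal form")**, `Φ`-frame (ours; engine 1's F★ normal form step): a graded endomorphism of `k[ε][σ]`
which is the identity modulo `σ` on constants, fixes the slots heavier than the class weight `c`, fixes `C g`, and whose
constant class pin map on `P = killLight (c ≤ w ·) g` is injective (K), FIXES `C (ε_V − m_V)` for suitable LIGHT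
`m_V ∈ k[ε]` of weight `c`, for every class slot `V`.  No homogeneity of `g` and no hypothesis on the characteristic are
used; in THEOREM F, (K) comes from the pin condition `(P)` through LEMMA K.  An instrument for the `W(f)` toy model, NOT a
resolution theorem. [cite: AbramovichTemkinWlodarczyk2024, Thm. 5.3.1 (2)–(3) (p. 1578)] -/
theorem exists_normalForm (hΦ : IsGradedHom w ρ Φ) (h0 : ∀ a, (Φ (C a)).coeff 0 = a)
    (hfix : ∀ i, c < w i → Φ (C (MvPolynomial.X i)) = C (MvPolynomial.X i)) (hw : ∀ i, 0 < w i) (hρ : 0 < ρ)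
    (hc : 0 < c) {g : MvPolynomial ι k} (hg : Φ (C g) = C g)
    (hK : ∀ T : ι → k, (∀ j, w j ≠ c → T j = 0) →
      ∑ j, MvPolynomial.C (T j) * MvPolynomial.pderiv j (killLight (fun j => c ≤ w j) g) = 0 → T = 0) :
    ∃ m : ι → MvPolynomial ι k, ∀ V, w V = c →
      MvPolynomial.IsWeightedHomogeneous w (m V) c ∧ IsLight w c (m V)
        ∧ Φ (C (MvPolynomial.X V - m V)) = C (MvPolynomial.X V - m V) := by
  set P := killLight (fun j => c ≤ w j) g with hP
  set R := MvPolynomial.weightedHomogeneousComponent (lightWt w c) c g with hR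
  set CV := (Finset.univ.filter fun j => w j = c) with hCV
  set BV := CV.biUnion fun j => (MvPolynomial.pderiv j P).support with hBV
  set A : Matrix {b // b ∈ BV} {j // j ∈ CV} k :=
    Matrix.of fun (b : {b // b ∈ BV}) (j : {j // j ∈ CV}) => MvPolynomial.coeff b.1 (MvPolynomial.pderiv j.1 P) with hA
  have hinj : Function.Injective A.mulVec := by
    refine mulVec_injective_of_pin P CV BV (fun j hj => Finset.subset_biUnion_of_mem (fun j => (MvPolynomial.pderiv j P).support) hj)
      fun T hT hT0 => hK T (fun j hj => hT j (by simpa [hCV] using hj)) hT0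
  obtain ⟨B, hBA⟩ := LTKit.exists_leftInv_of_mulVec_injective A hinj
  have hRh : MvPolynomial.IsWeightedHomogeneous (lightWt w c) R c := by
    rw [hR]; exact MvPolynomial.weightedHomogeneousComponent_isWeightedHomogeneous c g
  -- the identities (ID_β) and the left inverse
  have hID : ∀ b : {b // b ∈ BV}, ∑ j, A b j • tMove w c Φ j.1 = opD Φ hΦ.map_C_C (-C (lightCoeff w c b.1 R)) := by
    intro b
    simp only [hA, Matrix.of_apply]
    exact module_identity hΦ h0 hfix hw hρ hc hg b.1
  have hT := LTKit.apply_eq_map_of_leftInv (opD Φ hΦ.map_C_C) A B hBA (fun j => tMove w c Φ j.1)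
    (fun b => -C (lightCoeff w c b.1 R)) hID
  -- the correction `m`
  let m : ι → MvPolynomial ι k := fun V =>
    if hV : V ∈ CV then ∑ b, B ⟨V, hV⟩ b • (-lightCoeff w c b.1 R) else 0
  refine ⟨m, fun V hV => ?_⟩
  have hVC : V ∈ CV := by simpa [hCV] using hV
  have hmV : m V = ∑ b, B ⟨V, hVC⟩ b • (-lightCoeff w c b.1 R) := dif_pos hVC
  refine ⟨?_, ?_, ?_⟩
  · rw [hmV]
    refine MvPolynomial.IsWeightedHomogeneous.sum _ _ _ fun b _ => ?_
    rw [MvPolynomial.smul_eq_C_mul]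
    have h := (MvPolynomial.isWeightedHomogeneous_C w (B ⟨V, hVC⟩ b)).mul
      ((MvPolynomial.weightedHomogeneousSubmodule k w c).neg_mem (isWeightedHomogeneous_lightCoeff w c hRh b.1))
    rwa [zero_add] at h
  · rw [hmV]
    exact IsLight.sum _ fun b _ => IsLight.smul _ (isLight_lightCoeff w c b.1 R).neg
  · have hTV := hT ⟨V, hVC⟩
    have hsum : ∑ b, B ⟨V, hVC⟩ b • (-C (lightCoeff w c b.1 R) : (MvPolynomial ι k)[X]) = C (m V) := by
      rw [hmV, map_sum]
      refine Finset.sum_congr rfl fun b _ => ?_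
      rw [← map_neg C, Polynomial.smul_C]
    rw [hsum, opD_apply, Polynomial.coeff_C_zero, tMove_of_eq w c Φ hV] at hTV
    rw [map_sub, map_sub, sub_eq_sub_iff_sub_eq_sub, hTV]

end NormalForm

end LemmaXL

end Literature.AlgebraicGeometry.Resolution.WeightedBlowup
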